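import Summits.Ventures.Crystal3D.Theorems.StickyWulffConstantCoaxialWallLawWordInstance
import Summits.Ventures.Crystal3D.Theorems.StickyWulffConstantCoaxialWallLawWordCoreStateInv
import HarnessLib

/-!
# The word automaton instantiated under a STATE invariant: no band (generic translation pairs, well-formed words)

HONEST FRAMING. Part of the venture `Summits/Ventures/Crystal3D` (cell `crystal3d-full`), helper for the crux
`CoaxialWallLaw` (stmt-Ventures-19481) of `route-Ventures-StickyWulffConstant`, REGISTERED line `WallLedgerF`
(planner cf-p1 gen 16), open stub `stub_coaxialTwoSlabAdhesion` (general fillings).  Sibling of 19481-p2's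
`word_sources_le_lists` (`…WordInstance`, W9a) and of `word_sources_le_lists_noTop` (`…WordInstanceNoTop`): the
same word instantiation (classes = well-formed words, certified states with multiplicity `220`, move map) fed into
the band-free abstract count `word_sources_le_of_stateInvariant` (`…WordCoreStateInv`), for a predicate `P` on
(ball, word) that holds at the first image of every source, is preserved by the move forms
`(b, κ) ↦ (b + F κ (u κ), κ)` and `(b, κ) ↦ (b + F κ' (u κ'), κ')`, `κ' = next κ m` along a crossing normal, and
excludes the top sample.  Purpose: TRANSLATION pairs with a 3-adically generic shift (next bricks).  Rung credit
only; F-C1 not moved.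

**Theorem (`word_sources_le_lists_stateInv`).**  Word data `F, u, WF, next` as in `word_sources_le_lists`; a
predicate `P` with the three properties above (stated for well-formed words); the top grain given by a frame `G₂`;
rising root direction; the two-slab cell.  Then the vertical tops of the inner bottom sample along `F [] (u [])` are
at most `13·220·#{deg ≤ 11 in the window} + 220·#rim_top + 220·#rim_bottom` — no band term.

WHAT THIS IS NOT: not the stub; the 3-adic invariant and the cell assembly are the next bricks; F-C1 not moved.
-/
noncomputable section

namespace Summit.Ventures.Crystal3D.Theorems

open Summit.Ventures.Crystal3D Finset
open Literature.MathematicalPhysics.StatisticalMechanics (fccStacking)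
open scoped InnerProductSpace

section Instance

variable {X : Finset (EuclideanSpace ℝ (Fin 3))}
  {F : List (EuclideanSpace ℝ (Fin 3)) → (EuclideanSpace ℝ (Fin 3) ≃ₗᵢ[ℝ] EuclideanSpace ℝ (Fin 3))}
  {u : List (EuclideanSpace ℝ (Fin 3)) → EuclideanSpace ℝ (Fin 3)}
  {WF : List (EuclideanSpace ℝ (Fin 3)) → Prop}
  {next : List (EuclideanSpace ℝ (Fin 3)) → EuclideanSpace ℝ (Fin 3) → List (EuclideanSpace ℝ (Fin 3))}
  {P₁ P' P₂ : Finset (EuclideanSpace ℝ (Fin 3))} {t₁ t₂ : EuclideanSpace ℝ (Fin 3)} {R₀ h ρ : ℝ}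

open scoped Classical in
/-- **The band-free NET count under a state invariant, instantiated for well-formed words.**  See the module
docstring. -/
theorem word_sources_le_lists_stateInv {δ : ℝ} (hg : KissingGap δ) (hc : KissingClassification δ)
    (hX : ∀ p ∈ X, ∀ q ∈ X, p ≠ q → 1 ≤ dist p q)
    (hFc : ∀ μ κ, F (μ :: κ) = ((ℝ ∙ μ)ᗮ.reflection).trans (F κ))
    (hu : ∀ κ, u κ ∈ fccSlots) (huc : ∀ μ κ, u (μ :: κ) = -u κ)
    (hWF0 : WF [])
    (hWFc : ∀ μ κ, WF (μ :: κ) ↔ (WF κ ∧ ‖μ‖ = 1 ∧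
      (∀ w ∈ fccSlots, ⟪w, μ⟫_ℝ = 0 ∨ ⟪w, μ⟫_ℝ = Real.sqrt (2 / 3) ∨ ⟪w, μ⟫_ℝ = -Real.sqrt (2 / 3)) ∧
      ⟪u κ, μ⟫_ℝ = Real.sqrt (2 / 3) ∧ ∀ μ' κ', κ = μ' :: κ' → μ' ≠ -μ))
    (hnext_pop : ∀ μ κ' (m : EuclideanSpace ℝ (Fin 3)), (F (μ :: κ')).symm m = -μ → next (μ :: κ') m = κ')
    (hnext_push : ∀ κ (m : EuclideanSpace ℝ (Fin 3)), (∀ μ κ', κ = μ :: κ' → (F κ).symm m ≠ -μ) →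
      next κ m = (F κ).symm m :: κ)
    -- the top grain's frame and the state invariant
    (G₂ : EuclideanSpace ℝ (Fin 3) ≃ₗᵢ[ℝ] EuclideanSpace ℝ (Fin 3))
    {P : EuclideanSpace ℝ (Fin 3) × List (EuclideanSpace ℝ (Fin 3)) → Prop}
    (hPfull : ∀ (b : EuclideanSpace ℝ (Fin 3)) (κ : List (EuclideanSpace ℝ (Fin 3))), WF κ →
      P (b, κ) → P (b + F κ (u κ), κ))
    (hPcross : ∀ (b : EuclideanSpace ℝ (Fin 3)) (κ : List (EuclideanSpace ℝ (Fin 3))) (m : EuclideanSpace ℝ (Fin 3)),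
      WF κ → WF (next κ m) → P (b, κ) → P (b + F (next κ m) (u (next κ m)), next κ m))
    (hPtop : ∀ (b : EuclideanSpace ℝ (Fin 3)) (κ : List (EuclideanSpace ℝ (Fin 3))), WF κ → P (b, κ) → b ∉ P₂)
    (hup : 0 < (F [] (u [])) 2)
    -- the cell
    (hR₀ : 3 ≤ R₀) (hρ : R₀ ≤ ρ)
    (hcell : ∀ p ∈ X, -(2 * R₀) ≤ p 2 ∧ p 2 ≤ h + 2 * R₀ ∧ p 0 ^ 2 + p 1 ^ 2 ≤ ρ ^ 2)
    (hP₁X : P₁ ⊆ X) (hP₂X : P₂ ⊆ X)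
    (hP₁ : ∀ p, p ∈ P₁ ↔ (p ∈ (fun q => F [] q + t₁) '' fccStacking 1 (Real.sqrt (2 / 3)) ∧
      -(2 * R₀) ≤ p 2 ∧ p 2 ≤ -R₀ ∧ p 0 ^ 2 + p 1 ^ 2 ≤ ρ ^ 2))
    (hP' : ∀ p, p ∈ P' ↔ (p ∈ (fun q => F [] q + t₁) '' fccStacking 1 (Real.sqrt (2 / 3)) ∧
      -(2 * R₀) + 1 ≤ p 2 ∧ p 2 ≤ -R₀ - 1 ∧ p 0 ^ 2 + p 1 ^ 2 ≤ (ρ - 1) ^ 2))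
    (hP'full : ∀ p ∈ P', ∀ w ∈ fccSlots, p + F [] w ∈ X)
    (hPsrc : ∀ p ∈ P', P (p + F [] (u []), []))
    (hP₂ : ∀ p, p ∈ P₂ ↔ (p ∈ (fun q => G₂ q + t₂) '' fccStacking 1 (Real.sqrt (2 / 3)) ∧
      h + R₀ ≤ p 2 ∧ p 2 ≤ h + 2 * R₀ ∧ p 0 ^ 2 + p 1 ^ 2 ≤ ρ ^ 2)) :
    (P'.filter fun p => (∀ w ∈ fccSlots, p + F [] w ∈ X) ∧
        -R₀ - 1 < (p + F [] (u [])) 2 ∧ (p + F [] (u [])) 2 < h + R₀ + 1).card ≤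
      13 * 220 * (X.filter fun z => (X.filter fun q => dist z q = 1).card ≤ 11 ∧
          -R₀ - 1 - 1 ≤ z 2 ∧ z 2 ≤ h + R₀ + 1 + 1).card +
      220 * (X.filter fun s => h + R₀ + 1 ≤ s 2 ∧ s 2 ≤ h + R₀ + 1 + 1 ∧ (ρ - 2) ^ 2 < s 0 ^ 2 + s 1 ^ 2).card +
      220 * (X.filter fun s => -R₀ - 1 - 1 ≤ s 2 ∧ s 2 < -R₀ - 1 ∧ (ρ - 1) ^ 2 < s 0 ^ 2 + s 1 ^ 2).card := by
  -- the class data on the subtype of well-formed words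
  set F' : {κ : List (EuclideanSpace ℝ (Fin 3)) // WF κ} →
      (EuclideanSpace ℝ (Fin 3) ≃ₗᵢ[ℝ] EuclideanSpace ℝ (Fin 3)) := fun κ => F κ.1 with hF'
  set d' : {κ : List (EuclideanSpace ℝ (Fin 3)) // WF κ} → EuclideanSpace ℝ (Fin 3) :=
    fun κ => F κ.1 (u κ.1) with hd'
  set next' : {κ : List (EuclideanSpace ℝ (Fin 3)) // WF κ} → EuclideanSpace ℝ (Fin 3) →
      {κ : List (EuclideanSpace ℝ (Fin 3)) // WF κ} := fun κ m =>
    @dite _ (WF (next κ.1 m)) (Classical.propDecidable _) (fun hw => ⟨next κ.1 m, hw⟩) (fun _ => κ) with hnext'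
  set root : {κ : List (EuclideanSpace ℝ (Fin 3)) // WF κ} := ⟨[], hWF0⟩ with hroot_def
  -- the class change along a crossing normal
  have hspec : ∀ (κ : {κ : List (EuclideanSpace ℝ (Fin 3)) // WF κ}) (m : EuclideanSpace ℝ (Fin 3)), ‖m‖ = 1 →
      (∀ w ∈ fccSlots, ⟪F' κ w, m⟫_ℝ = 0 ∨ ⟪F' κ w, m⟫_ℝ = Real.sqrt (2 / 3) ∨ ⟪F' κ w, m⟫_ℝ = -Real.sqrt (2 / 3)) →
      ⟪d' κ, m⟫_ℝ = Real.sqrt (2 / 3) →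
      (next' κ m).1 = next κ.1 m ∧ (∀ x, F (next κ.1 m) x = F κ.1 x - (2 * ⟪F κ.1 x, m⟫_ℝ) • m) ∧
        ⟪F (next κ.1 m) (u (next κ.1 m)), m⟫_ℝ = Real.sqrt (2 / 3) ∧ next (next κ.1 m) m = κ.1 := by
    intro κ m hm hmenu hdm
    obtain ⟨hwf, hfr, hdir, hinv⟩ := word_next_spec hFc huc hWFc hnext_pop hnext_push κ.2 hm hmenu hdm
    refine ⟨?_, hfr, hdir, hinv⟩
    simp only [hnext']
    rw [dif_pos hwf]
  have hmirror : ∀ (κ : {κ : List (EuclideanSpace ℝ (Fin 3)) // WF κ}) (m : EuclideanSpace ℝ (Fin 3)), ‖m‖ = 1 →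
      (∀ w ∈ fccSlots, ⟪F' κ w, m⟫_ℝ = 0 ∨ ⟪F' κ w, m⟫_ℝ = Real.sqrt (2 / 3) ∨ ⟪F' κ w, m⟫_ℝ = -Real.sqrt (2 / 3)) →
      ⟪d' κ, m⟫_ℝ = Real.sqrt (2 / 3) → ∀ x, F' (next' κ m) x = F' κ x - (2 * ⟪F' κ x, m⟫_ℝ) • m := by
    intro κ m hm hmenu hdm x
    obtain ⟨h1, hfr, -, -⟩ := hspec κ m hm hmenu hdm
    show F (next' κ m).1 x = F κ.1 x - (2 * ⟪F κ.1 x, m⟫_ℝ) • m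
    rw [h1]; exact hfr x
  have hinv : ∀ (κ : {κ : List (EuclideanSpace ℝ (Fin 3)) // WF κ}) (m : EuclideanSpace ℝ (Fin 3)), ‖m‖ = 1 →
      (∀ w ∈ fccSlots, ⟪F' κ w, m⟫_ℝ = 0 ∨ ⟪F' κ w, m⟫_ℝ = Real.sqrt (2 / 3) ∨ ⟪F' κ w, m⟫_ℝ = -Real.sqrt (2 / 3)) →
      ⟪d' κ, m⟫_ℝ = Real.sqrt (2 / 3) → next' (next' κ m) m = κ := by
    intro κ m hm hmenu hdm
    obtain ⟨h1, -, -, hback⟩ := hspec κ m hm hmenu hdm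
    apply Subtype.ext
    have h2 : (next' (next' κ m) m).1 = next (next' κ m).1 m := by
      simp only [hnext']
      rw [dif_pos]
      rw [h1, hback]; exact κ.2
    rw [h2, h1, hback]
  have hdnext : ∀ (κ : {κ : List (EuclideanSpace ℝ (Fin 3)) // WF κ}) (m : EuclideanSpace ℝ (Fin 3)), ‖m‖ = 1 →
      (∀ w ∈ fccSlots, ⟪F' κ w, m⟫_ℝ = 0 ∨ ⟪F' κ w, m⟫_ℝ = Real.sqrt (2 / 3) ∨ ⟪F' κ w, m⟫_ℝ = -Real.sqrt (2 / 3)) →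
      ⟪d' κ, m⟫_ℝ = Real.sqrt (2 / 3) → ⟪d' (next' κ m), m⟫_ℝ = Real.sqrt (2 / 3) := by
    intro κ m hm hmenu hdm
    obtain ⟨h1, -, hdir, -⟩ := hspec κ m hm hmenu hdm
    show ⟪F (next' κ m).1 (u (next' κ m).1), m⟫_ℝ = Real.sqrt (2 / 3)
    rw [h1]; exact hdir
  have hd : ∀ κ : {κ : List (EuclideanSpace ℝ (Fin 3)) // WF κ}, ∃ u' ∈ fccSlots, d' κ = F' κ u' :=
    fun κ => ⟨u κ.1, hu κ.1, rfl⟩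
  have hdn : ∀ κ : {κ : List (EuclideanSpace ℝ (Fin 3)) // WF κ}, ∃ m : EuclideanSpace ℝ (Fin 3), ‖m‖ = 1 ∧
      (∀ w ∈ fccSlots, ⟪F' κ w, m⟫_ℝ = 0 ∨ ⟪F' κ w, m⟫_ℝ = Real.sqrt (2 / 3) ∨ ⟪F' κ w, m⟫_ℝ = -Real.sqrt (2 / 3)) ∧
      ⟪d' κ, m⟫_ℝ = Real.sqrt (2 / 3) := fun κ => exists_menuNormal_far (F κ.1) (hu κ.1)
  -- rigidity: the slot dozen determines the word
  have hinjK : ∀ κ κ' : {κ : List (EuclideanSpace ℝ (Fin 3)) // WF κ},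
      (F' κ : EuclideanSpace ℝ (Fin 3) → EuclideanSpace ℝ (Fin 3)) '' ↑fccSlots =
      (F' κ' : EuclideanSpace ℝ (Fin 3) → EuclideanSpace ℝ (Fin 3)) '' ↑fccSlots → κ = κ' :=
    fun κ κ' himg => Subtype.ext (word_eq_of_image_eq hFc huc hWFc κ.2 κ'.2 himg)
  have hrig : ∀ κ κ' : {κ : List (EuclideanSpace ℝ (Fin 3)) // WF κ},
      (∃ a ∈ fccSlots, ∃ a' ∈ fccSlots, ∃ a'' ∈ fccSlots,
        ⟪a, a'⟫_ℝ = 1 / 2 ∧ ⟪a, a''⟫_ℝ = 1 / 2 ∧ ⟪a', a''⟫_ℝ = 1 / 2 ∧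
        (∃ w ∈ fccSlots, F' κ' w = F' κ a) ∧ (∃ w ∈ fccSlots, F' κ' w = F' κ a') ∧
        (∃ w ∈ fccSlots, F' κ' w = F' κ a'')) → κ = κ' :=
    fun κ κ' htri => Subtype.ext (word_eq_of_triangle hFc huc hWFc κ.2 κ'.2 htri)
  -- the certified states and the move map
  obtain ⟨W, hW, hmult⟩ := exists_certified_states (F := F') (d := d') hX hinjK
  obtain ⟨f, hf_full, hf_cross, hf_glide⟩ := exists_word_move_map X F' d' next'
  -- the invariant, lifted to the subtype of well-formed words
  set Pw : EuclideanSpace ℝ (Fin 3) × {κ : List (EuclideanSpace ℝ (Fin 3)) // WF κ} → Prop :=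
    fun v => P (v.1, v.2.1) with hPwdef
  have hPsrc' : ∀ p ∈ P', (∀ w ∈ fccSlots, p + F' root w ∈ X) → Pw (p + d' root, root) :=
    fun p hp _ => hPsrc p hp
  have hPfull' : ∀ v ∈ W, Pw v → Pw (v.1 + d' v.2, v.2) := fun v _ hv => hPfull v.1 v.2.1 v.2.2 hv
  have hPcross' : ∀ v ∈ W, ∀ (m : EuclideanSpace ℝ (Fin 3)), ‖m‖ = 1 →
      (∀ w ∈ fccSlots, ⟪F' v.2 w, m⟫_ℝ = 0 ∨ ⟪F' v.2 w, m⟫_ℝ = Real.sqrt (2 / 3) ∨ ⟪F' v.2 w, m⟫_ℝ = -Real.sqrt (2 / 3)) →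
      ⟪d' v.2, m⟫_ℝ = Real.sqrt (2 / 3) → Pw v → Pw (v.1 + d' (next' v.2 m), next' v.2 m) := by
    intro v _ m hm hmenu hdm hv
    obtain ⟨h1, -, -, -⟩ := hspec v.2 m hm hmenu hdm
    have hwf : WF (next v.2.1 m) := by rw [← h1]; exact (next' v.2 m).2
    show P ((v.1 + F (next' v.2 m).1 (u (next' v.2 m).1), (next' v.2 m).1))
    rw [h1]
    exact hPcross v.1 v.2.1 m v.2.2 hwf hv
  have hPtop' : ∀ v ∈ W, Pw v → v.1 ∉ P₂ := fun v _ hv => hPtop v.1 v.2.1 v.2.2 hv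
  -- the abstract band-free count
  have key := word_sources_le_of_stateInvariant (root := root) (G₂ := G₂) (P := Pw) hg hc hX hd hdn hmirror hinv
    hdnext hW hmult (fun v _ => hf_full v) (fun v _ => hf_cross v) (fun v _ => hf_glide v)
    (fun κ hκ => hrig κ root hκ) hup hPsrc' hPfull' hPcross' hPtop' hR₀ hρ hcell hP₁X hP₂X hP₁ hP' hP'full hP₂
  exact key

end Instance

end Summit.Ventures.Crystal3D.Theorems

end
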